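import Summits.QuantumFields.BalabanUV.Beta.GAN24.FineReadoutAlias

/-!
# `BalabanUV.Beta.GAN24.FineReadoutAliasFold` — binder row G-an2-4 / (CONV-C), S-slot located remainder «E3Shape», route «S3-fibre²», node E3A2 part 2 of
# `HOME/b2b-balaban-gan24-formalise-leaf-16/g8/E3A-READOUT.md` §3 (companion of `GAN24/FineReadoutAlias`, SAME namespace; split only for the 400-line lint):
# THE PER-ALIAS STRIP BOUND IN THE FOLDED-COORDINATE CURRENCY (`fold_i = |srep m i|`, `F = ‖srep m‖∞`)

NOT IN PRINT; OUR PROOF ATTEMPT (of the road; [folklore] bookkeeping over `GAN24/FineReadoutAlias` §1–§3, leaf-17's `four_mul_fold_sq_le_sq_mul_lapR`, leaf-18's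
`norm_chiAl_sq_le_strip`, leaf-14's `AliasReindex.srep`).  HONEST FRAMING (cell contract, verbatim): «discharging `BetaPertH` makes Bałaban's UV stability UNCONDITIONAL
— a real constructive-QFT result; it is NOT the continuum limit and NOT the Clay problem.»  HONEST DEPENDENCY (verbatim): «continuum YM on T⁴ ⇐ BetaPertH ∧ nine spine
estimates (0/9 proved); BetaPertH ⇐ (D1) ∧ (D4) ∧ CAP+tail; G-an2-4 gates asym, D1 and NE2/3/4.»  No cited fact, no wall binder, no `def … : Prop`; discharges NOTHING
of (hS, hSall) / «E3Shape»; NOT `BetaPertH`, NOT continuum, NOT Clay.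

## What is proved (`m : TorusSite D N`; strip `|Re p_i| ≤ π`, `|Im p_i| ≤ η`, `0 ≤ η ≤ 1/4`, `(3D/2+2)η ≤ 1/2`)
`fold`, `wfold`, `Fsup` and their dictionary with `srep` (`abs_srep_cast_eq_fold`, `srep_eq_zero_iff`, `one_le_fold`, `one_le_Fsup`); `wMaj_le_two_mul_wfold_sq`;
`norm_chiAl_le_prod` (`‖χ̂_m‖ ≤ √12^D·Π wfold`); `two_mul_Fsup_le` (`2F ≤ N√Λ`), `inv_lapR_le`, `sqrt_div_lapR_sq_le`; and **`norm_Asol_border_le`** (`m ≠ 0`):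
`‖Asol (∂̂_m) (∂̂♭_m) (χ̂_m s♭(m) ⊙ φ) (L_m) (χ̂_m c) κ‖ ≤ (√12^D·√6·(1+8D))·N³·(Φ/F² + Cc/F³)·Π_i wfold m i` — the summand of `AliasPointSum.pointWeight (−1)` / `(−2)`
at `srep m`, times `N³`.
Unit `b2b-balaban-gan24-formalise-leaf-16` (G-an2-4 formalisation swarm, leaf prover 16, gen 8), 2026-08-20.
-/

noncomputable section

open Complex Finset
open scoped BigOperators Real
open Literature.Probability.LatticeModels (TorusSite)
open Literature.MathematicalPhysics.QuantumFieldTheory.Balaban1983to89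
open B4Strip (reVec)
open Summit.QuantumFields.BalabanUV.Beta.GAN24.FibreBlockSolve (dot Asol)
open Summit.QuantumFields.BalabanUV.Beta.GAN24.AliasWeights (sinWt sinWt_pos sinWt_le_one kfine wMaj sinWt_kfine_le_wMaj)
open Summit.QuantumFields.BalabanUV.Beta.GAN24.AliasWeightsSum (lapR lapR_nonneg four_mul_fold_sq_le_sq_mul_lapR)
open Summit.QuantumFields.BalabanUV.Beta.GAN24.AliasObjects (chiAl sbAl dAl dbAl LAl)
open Summit.QuantumFields.BalabanUV.Beta.GAN24.StripAliasWeights (norm_chiAl_sq_le_strip)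
open Summit.QuantumFields.BalabanUV.Beta.GAN24.ArrowAnchorZeroMomenta (exists_ne_zero_of_ne_zero)

namespace Summit.QuantumFields.BalabanUV.Beta.GAN24.FineReadoutAlias

/-! ## §4 The folded-coordinate currency: `fold_i = min(val, N − val) = |srep m i|`, `F = max_i fold_i` -/

section Folded

open Summit.QuantumFields.BalabanUV.Beta.GAN24.AliasReindex (srep natAbs_srep_eq_min)

variable {D N : ℕ} [NeZero N] {p : Fin D → ℂ} {η : ℝ}

/-- [folklore] The folded coordinate of an alias class (`= |srep m i|`, leaf-14's `natAbs_srep_eq_min`). -/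
def fold (m : TorusSite D N) (i : Fin D) : ℕ := min (m i).val (N - (m i).val)

/-- [folklore] `fold m i = |srep m i|` as a natural number. -/
theorem natAbs_srep_eq_fold (m : TorusSite D N) (i : Fin D) : (srep m i).natAbs = fold m i :=
  natAbs_srep_eq_min m i

/-- [folklore] `|(srep m i : ℝ)| = fold m i`. -/
theorem abs_srep_cast_eq_fold (m : TorusSite D N) (i : Fin D) : |((srep m i : ℤ) : ℝ)| = (fold m i : ℝ) := by
  rw [← natAbs_srep_eq_fold, ← Int.cast_abs, ← Int.natCast_natAbs, Int.cast_natCast]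

omit [NeZero N] in
/-- [folklore] `srep m i = 0 ↔ m i = 0`. -/
theorem srep_eq_zero_iff (m : TorusSite D N) (i : Fin D) : srep m i = 0 ↔ m i = 0 :=
  ZMod.valMinAbs_eq_zero (m i)

/-- [folklore] A nonzero coordinate has fold `≥ 1`. -/
theorem one_le_fold {m : TorusSite D N} {i : Fin D} (hi : m i ≠ 0) : 1 ≤ fold m i := by
  have hv : 0 < (m i).val := Nat.pos_of_ne_zero fun h => hi ((ZMod.val_eq_zero _).1 h)
  have hlt : (m i).val < N := ZMod.val_lt _
  exact le_min hv (by omega)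

omit [NeZero N] in
/-- [folklore] The zero coordinate has fold `0`. -/
theorem fold_eq_zero {m : TorusSite D N} {i : Fin D} (hi : m i = 0) : fold m i = 0 := by
  simp [fold, hi]

/-- [folklore] THE POINT-READING WEIGHT of one coordinate: `1` on the zero class, `|srep m i|⁻¹ = fold_i⁻¹` otherwise
(the factor of leaf-16's `AliasPointSum.pointWeight` at `j = srep m`). -/
def wfold (m : TorusSite D N) (i : Fin D) : ℝ := if srep m i = 0 then 1 else |((srep m i : ℤ) : ℝ)|⁻¹

omit [NeZero N] in
/-- [folklore] `0 ≤ wfold m i`. -/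
theorem wfold_nonneg (m : TorusSite D N) (i : Fin D) : 0 ≤ wfold m i := by
  unfold wfold; split_ifs <;> positivity

/-- [folklore] Leaf-17's one-coordinate majorant is dominated by twice the squared point weight: `wMaj N (m i) ≤ 2·(wfold m i)²`. -/
theorem wMaj_le_two_mul_wfold_sq (m : TorusSite D N) (i : Fin D) : wMaj N (m i) ≤ 2 * wfold m i ^ 2 := by
  unfold wMaj wfold
  by_cases hi : m i = 0
  · rw [if_pos hi, if_pos ((srep_eq_zero_iff m i).2 hi)]; norm_num
  · rw [if_neg hi, if_neg (fun h => hi ((srep_eq_zero_iff m i).1 h)), abs_srep_cast_eq_fold]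
    have h1 : (1 : ℝ) ≤ (fold m i : ℝ) := by exact_mod_cast one_le_fold hi
    have hv : (fold m i : ℝ) ≤ ((m i).val : ℝ) := by exact_mod_cast min_le_left _ _
    have hw : (fold m i : ℝ) ≤ ((N - (m i).val : ℕ) : ℝ) := by exact_mod_cast min_le_right _ _
    have hf0 : (0 : ℝ) < (fold m i : ℝ) := by linarith
    have ha : (((m i).val : ℝ) ^ 2)⁻¹ ≤ ((fold m i : ℝ) ^ 2)⁻¹ :=
      inv_anti₀ (by positivity) (pow_le_pow_left₀ hf0.le hv 2)
    have hb : ((((N - (m i).val : ℕ) : ℝ)) ^ 2)⁻¹ ≤ ((fold m i : ℝ) ^ 2)⁻¹ :=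
      inv_anti₀ (by positivity) (pow_le_pow_left₀ hf0.le hw 2)
    rw [inv_pow]
    linarith

/-- [folklore] **`‖χ̂_m‖ ≤ (2√3)^D · Π_i wfold m i`** ON THE STRIP (`StripAliasWeights.norm_chiAl_sq_le_strip` ∘ `AliasWeights.sinWt_kfine_le_wMaj` ∘ the previous lemma). -/
theorem norm_chiAl_le_prod (hre : ∀ i, |(p i).re| ≤ π) (him : ∀ i, |(p i).im| ≤ η) (hη : 0 ≤ η) (hη4 : η ≤ 1 / 4) (m : TorusSite D N) :
    ‖chiAl N p m‖ ≤ Real.sqrt 12 ^ D * ∏ i, wfold m i := by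
  have h := norm_chiAl_sq_le_strip him hη hη4 m
  have hprod : ∏ i, sinWt N (kfine N (reVec p) m i) ≤ ∏ i, (2 * wfold m i ^ 2) :=
    Finset.prod_le_prod (fun i _ => (sinWt_pos _ _).le) fun i _ =>
      (sinWt_kfine_le_wMaj (p := reVec p) (fun i => hre i) m i).trans (wMaj_le_two_mul_wfold_sq m i)
  have hsq : ‖chiAl N p m‖ ^ 2 ≤ (Real.sqrt 12 ^ D * ∏ i, wfold m i) ^ 2 := by
    calc ‖chiAl N p m‖ ^ 2 ≤ (6 : ℝ) ^ D * ∏ i, sinWt N (kfine N (reVec p) m i) := h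
      _ ≤ (6 : ℝ) ^ D * ∏ i, (2 * wfold m i ^ 2) := mul_le_mul_of_nonneg_left hprod (by positivity)
      _ = (Real.sqrt 12 ^ D * ∏ i, wfold m i) ^ 2 := by
          rw [Finset.prod_mul_distrib, Finset.prod_const, Finset.card_univ, Fintype.card_fin, Finset.prod_pow, mul_pow, ← pow_mul,
            mul_comm D 2, pow_mul, Real.sq_sqrt (by norm_num), show (12 : ℝ) ^ D = 2 ^ D * 6 ^ D by rw [← mul_pow]; norm_num]
          ring
  exact (pow_le_pow_iff_left₀ (norm_nonneg _)
    (mul_nonneg (pow_nonneg (Real.sqrt_nonneg _) _) (Finset.prod_nonneg fun i _ => wfold_nonneg m i)) two_ne_zero).1 hsq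

/-- [folklore] The sup norm of the symmetric representative, `F = max_i fold_i`. -/
def Fsup (m : TorusSite D N) : ℝ := ‖fun i => ((srep m i : ℤ) : ℝ)‖

/-- [folklore] `1 ≤ F` for a nonzero alias class. -/
theorem one_le_Fsup {m : TorusSite D N} (hm : m ≠ 0) : 1 ≤ Fsup m := by
  obtain ⟨i, hi⟩ := exists_ne_zero_of_ne_zero hm
  have h1 : (1 : ℝ) ≤ |((srep m i : ℤ) : ℝ)| := by rw [abs_srep_cast_eq_fold]; exact_mod_cast one_le_fold hi
  have h2 : ‖(fun i => ((srep m i : ℤ) : ℝ)) i‖ ≤ Fsup m := norm_le_pi_norm (fun i => ((srep m i : ℤ) : ℝ)) i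
  rw [Real.norm_eq_abs] at h2
  exact h1.trans h2

/-- [folklore] **`2F ≤ N·√Λ`**: every folded coordinate satisfies `4·fold_i² ≤ N²·Λ` (leaf-17 BY NAME), hence so does their maximum. -/
theorem two_mul_Fsup_le (hre : ∀ i, |(p i).re| ≤ π) (m : TorusSite D N) :
    2 * Fsup m ≤ N * Real.sqrt (lapR (kfine N (reVec p) m)) := by
  set Λ := lapR (kfine N (reVec p) m)
  have hΛ0 : 0 ≤ Λ := lapR_nonneg _
  have hN : (0 : ℝ) ≤ N := Nat.cast_nonneg N
  suffices h : Fsup m ≤ N * Real.sqrt Λ / 2 by linarith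
  refine (pi_norm_le_iff_of_nonneg (by positivity)).2 fun i => ?_
  rw [Real.norm_eq_abs, abs_srep_cast_eq_fold]
  by_cases hi : m i = 0
  · rw [fold_eq_zero hi]; simp only [Nat.cast_zero]; positivity
  · have h4 := four_mul_fold_sq_le_sq_mul_lapR (p := reVec p) (fun i => hre i) m hi
    have hsq : ((fold m i : ℕ) : ℝ) ^ 2 ≤ (N * Real.sqrt Λ / 2) ^ 2 := by
      rw [div_pow, mul_pow, Real.sq_sqrt hΛ0]
      change ((min (m i).val (N - (m i).val) : ℕ) : ℝ) ^ 2 ≤ _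
      linarith
    exact (pow_le_pow_iff_left₀ (Nat.cast_nonneg _) (by positivity) two_ne_zero).1 hsq

/-- [folklore] `1/Λ ≤ N²/(4F²)` for a nonzero alias class. -/
theorem inv_lapR_le (hre : ∀ i, |(p i).re| ≤ π) {m : TorusSite D N} (hm : m ≠ 0) :
    1 / lapR (kfine N (reVec p) m) ≤ (N : ℝ) ^ 2 / (4 * Fsup m ^ 2) := by
  have hΛ := lapR_pos hre hm
  have hF := one_le_Fsup hm
  have h2 := two_mul_Fsup_le hre m
  have h4 : 4 * Fsup m ^ 2 ≤ (N : ℝ) ^ 2 * lapR (kfine N (reVec p) m) := by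
    have := pow_le_pow_left₀ (by linarith) h2 2
    rw [mul_pow, mul_pow, Real.sq_sqrt hΛ.le] at this
    linarith
  rw [div_le_div_iff₀ hΛ (by positivity)]
  linarith

/-- [folklore] `√Λ/Λ² ≤ N³/(8F³)` for a nonzero alias class (the pure-gauge part: `Λ^{−3/2} = (√Λ)^{−3}` and `2F ≤ N√Λ`). -/
theorem sqrt_div_lapR_sq_le (hre : ∀ i, |(p i).re| ≤ π) {m : TorusSite D N} (hm : m ≠ 0) :
    Real.sqrt (lapR (kfine N (reVec p) m)) / lapR (kfine N (reVec p) m) ^ 2 ≤ (N : ℝ) ^ 3 / (8 * Fsup m ^ 3) := by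
  set Λ := lapR (kfine N (reVec p) m) with hΛdef
  have hΛ : 0 < Λ := lapR_pos hre hm
  have hF := one_le_Fsup hm
  set t := Real.sqrt Λ with ht
  have ht0 : 0 < t := Real.sqrt_pos.2 hΛ
  have htt : t ^ 2 = Λ := Real.sq_sqrt hΛ.le
  have h2 : 2 * Fsup m ≤ N * t := two_mul_Fsup_le hre m
  have h3 : (2 * Fsup m) ^ 3 ≤ (N * t) ^ 3 := pow_le_pow_left₀ (by linarith) h2 3
  rw [← htt, div_le_div_iff₀ (by positivity) (by positivity)]
  -- t * (8 F³) ≤ N³ * (t²)²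
  have : t * (8 * Fsup m ^ 3) ≤ t * ((N : ℝ) ^ 3 * t ^ 3) := by
    apply mul_le_mul_of_nonneg_left _ ht0.le
    calc 8 * Fsup m ^ 3 = (2 * Fsup m) ^ 3 := by ring
      _ ≤ (N * t) ^ 3 := h3
      _ = (N : ℝ) ^ 3 * t ^ 3 := by ring
  calc t * (8 * Fsup m ^ 3) ≤ t * ((N : ℝ) ^ 3 * t ^ 3) := this
    _ = (N : ℝ) ^ 3 * (t ^ 2) ^ 2 := by ring

/-- [folklore] **THE PER-ALIAS STRIP BOUND OF THE MINIMISER AMPLITUDE** (`m ≠ 0`; `0 ≤ η ≤ 1/4`, `(3D/2+2)η ≤ 1/2`; border data `‖φ_l‖ ≤ Φ`, `‖c‖ ≤ Cc`):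
`‖Asol (∂̂_m) (∂̂♭_m) (χ̂_m s♭(m) ⊙ φ) (L_m) (χ̂_m c) κ‖ ≤ K_D · N³ · (Φ/F² + Cc/F³) · Π_i [srep m i = 0 ? 1 : |srep m i|⁻¹]`,
`K_D = (√12)^D · √6 · (1 + 8D)`, `F = ‖srep m‖∞` — i.e. `K_D·N³·(Φ·pointWeight(−1) + Cc·pointWeight(−2))(srep m)` in leaf-16's `AliasPointSum` currency. -/
theorem norm_Asol_border_le (hre : ∀ i, |(p i).re| ≤ π) (him : ∀ i, |(p i).im| ≤ η) (hη : 0 ≤ η) (hη4 : η ≤ 1 / 4)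
    (hηD : (3 * D / 2 + 2) * η ≤ 1 / 2) {m : TorusSite D N} (hm : m ≠ 0) {φ : Fin D → ℂ} {c : ℂ} {Φ Cc : ℝ}
    (hΦ : ∀ l, ‖φ l‖ ≤ Φ) (hCc : ‖c‖ ≤ Cc) (κ : Fin D) :
    ‖Asol (dAl N p m) (dbAl N p m) (fun l => chiAl N p m * sbAl N p m l * φ l) (LAl N p m) (chiAl N p m * c) κ‖
      ≤ (Real.sqrt 12 ^ D * (Real.sqrt 6 * (1 + 8 * D))) * (N : ℝ) ^ 3 * (Φ / Fsup m ^ 2 + Cc / Fsup m ^ 3) * ∏ i, wfold m i := by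
  have h3 := norm_Asol_border_le_lapR hre him hη hη4 hηD hm hΦ hCc κ
  set Λ := lapR (kfine N (reVec p) m) with hΛdef
  have hΛ : 0 < Λ := lapR_pos hre hm
  have hF := one_le_Fsup hm
  have hΦ0 : 0 ≤ Φ := (norm_nonneg _).trans (hΦ κ)
  have hCc0 : 0 ≤ Cc := (norm_nonneg _).trans hCc
  have hN : (0 : ℝ) ≤ N := Nat.cast_nonneg N
  have hW : 0 ≤ ∏ i, wfold m i := Finset.prod_nonneg fun i _ => wfold_nonneg m i
  have hχ := norm_chiAl_le_prod hre him hη hη4 m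
  have hinv := inv_lapR_le hre hm
  have hsq := sqrt_div_lapR_sq_le hre hm
  have hD : (0 : ℝ) ≤ D := Nat.cast_nonneg D
  -- the bracket of §3 in the folded currency
  have hbr : Real.sqrt 6 * N * Φ * (1 + 8 * D) / Λ + 8 * Cc * Real.sqrt Λ / Λ ^ 2
      ≤ (Real.sqrt 6 * (1 + 8 * D)) * (N : ℝ) ^ 3 * (Φ / Fsup m ^ 2 + Cc / Fsup m ^ 3) := by
    have hA : Real.sqrt 6 * N * Φ * (1 + 8 * D) / Λ ≤ Real.sqrt 6 * N * Φ * (1 + 8 * D) * ((N : ℝ) ^ 2 / (4 * Fsup m ^ 2)) := by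
      rw [div_eq_mul_one_div]
      exact mul_le_mul_of_nonneg_left hinv (by positivity)
    have hB : 8 * Cc * Real.sqrt Λ / Λ ^ 2 ≤ 8 * Cc * ((N : ℝ) ^ 3 / (8 * Fsup m ^ 3)) := by
      rw [mul_div_assoc]
      exact mul_le_mul_of_nonneg_left hsq (by positivity)
    have hA' : Real.sqrt 6 * N * Φ * (1 + 8 * D) * ((N : ℝ) ^ 2 / (4 * Fsup m ^ 2))
        ≤ (Real.sqrt 6 * (1 + 8 * D)) * (N : ℝ) ^ 3 * (Φ / Fsup m ^ 2) := by
      rw [show Real.sqrt 6 * N * Φ * (1 + 8 * D) * ((N : ℝ) ^ 2 / (4 * Fsup m ^ 2))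
          = (1 / 4) * ((Real.sqrt 6 * (1 + 8 * D)) * (N : ℝ) ^ 3 * (Φ / Fsup m ^ 2)) by ring]
      have : 0 ≤ (Real.sqrt 6 * (1 + 8 * D)) * (N : ℝ) ^ 3 * (Φ / Fsup m ^ 2) := by positivity
      linarith
    have hB' : 8 * Cc * ((N : ℝ) ^ 3 / (8 * Fsup m ^ 3)) ≤ (Real.sqrt 6 * (1 + 8 * D)) * (N : ℝ) ^ 3 * (Cc / Fsup m ^ 3) := by
      rw [show 8 * Cc * ((N : ℝ) ^ 3 / (8 * Fsup m ^ 3)) = 1 * ((N : ℝ) ^ 3 * (Cc / Fsup m ^ 3)) by ring]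
      rw [show (Real.sqrt 6 * (1 + 8 * D)) * (N : ℝ) ^ 3 * (Cc / Fsup m ^ 3) = (Real.sqrt 6 * (1 + 8 * D)) * ((N : ℝ) ^ 3 * (Cc / Fsup m ^ 3)) by ring]
      apply mul_le_mul_of_nonneg_right _ (by positivity)
      have h6 : (2 : ℝ) ≤ Real.sqrt 6 := by
        rw [show (2:ℝ) = Real.sqrt 4 by rw [show (4:ℝ) = 2^2 by norm_num, Real.sqrt_sq (by norm_num)]]
        exact Real.sqrt_le_sqrt (by norm_num)
      nlinarith
    calc _ ≤ _ := add_le_add (hA.trans hA') (hB.trans hB')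
      _ = (Real.sqrt 6 * (1 + 8 * D)) * (N : ℝ) ^ 3 * (Φ / Fsup m ^ 2 + Cc / Fsup m ^ 3) := by ring
  have hbr0 : 0 ≤ Real.sqrt 6 * N * Φ * (1 + 8 * D) / Λ + 8 * Cc * Real.sqrt Λ / Λ ^ 2 := by positivity
  calc _ ≤ ‖chiAl N p m‖ * (Real.sqrt 6 * N * Φ * (1 + 8 * D) / Λ + 8 * Cc * Real.sqrt Λ / Λ ^ 2) := h3
    _ ≤ (Real.sqrt 12 ^ D * ∏ i, wfold m i) * ((Real.sqrt 6 * (1 + 8 * D)) * (N : ℝ) ^ 3 * (Φ / Fsup m ^ 2 + Cc / Fsup m ^ 3)) :=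
        mul_le_mul hχ hbr hbr0 (by positivity)
    _ = (Real.sqrt 12 ^ D * (Real.sqrt 6 * (1 + 8 * D))) * (N : ℝ) ^ 3 * (Φ / Fsup m ^ 2 + Cc / Fsup m ^ 3) * ∏ i, wfold m i := by ring

end Folded

end Summit.QuantumFields.BalabanUV.Beta.GAN24.FineReadoutAlias

end
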